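import Summits.ResolutionOfSingularities.ResolutionOfSingularities.Theorems.WeightedInvariantLexMaxOrderDropCompetitor
import Summits.ResolutionOfSingularities.ResolutionOfSingularities.Theorems.AQSHeightTwoSlopeFiltration
import Summits.ResolutionOfSingularities.ResolutionOfSingularities.Theorems.WeightedInvariantLexMaxOrderDropFace
import Summits.ResolutionOfSingularities.ResolutionOfSingularities.Theorems.WeightedInvariantHypersurfaceLocalGameEFTPointMoveDrop
import Summits.ResolutionOfSingularities.ResolutionOfSingularities.Theorems.WeightedInvariantHypersurfaceLocalGameEFTDimTwoTangent
import Summits.ResolutionOfSingularities.ResolutionOfSingularities.Theorems.WeightedInvariantHypersurfaceLocalGameEFTDimTwoNewtonFace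
import HarnessLib

/-!
# Abramovich–Quek–Schober Thm 1.3 (3) in kernel, local-algebra form: the order drops on `B₊` under the blow-up of the
# lex-maximal weighted centre (door `HypersurfaceCentreConstruction`, (o25-β))

Topic: `Summits/ResolutionOfSingularities/ResolutionOfSingularities/Theorems`. Helper for the door item
`HypersurfaceCentreConstruction` (statement `stmt-ResolutionOfSingularities-19897`, route `WeightedInvariant`), line
`local-engine` of `res-L1-w43-plan-1`, ORDER (o25-β) (DEALS gen 9 #21, 2026-08-27T09:27:57Z): clause (3) of the named fact
`AbramovichQuekSchober2025_heightTwoCentre` (`Literature/…/HypersurfaceHeightTwoWeightedCentre.lean`) in its LOCAL-ALGEBRA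
form, with the lex-maximal data as HYPOTHESES (`IsLexMaxWeightedCentreGerm S (span {f}) x w ℓ`, `ℓ / w 0 = ord f`).
Part 2b (part 1 = the field step `…LexMaxOrderDropFace`; part 2a = the competitor lemma `…LexMaxOrderDropCompetitor`;
the `ν ≥ 2` / `adicOrder` corollaries are in `…LexMaxOrderDropOrder`).

[OURS · L1 W4.3] Replaces the role of NO printed item of the manuscript under review [claim: Hironaka2017,
status: under-review]; re-proves in the tree's vocabulary Abramovich–Quek–Schober 2025 Thm 1.3 (3) («the order of the proper
transform of `C` at every point of the blow-up lying over `q` is strictly smaller than `a₁`», arXiv:2507.01232v3 §5).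
AI work, weaker than expert review.

## Statement (`iotaOrd_transform_lt_of_isLexMax`)

`S` regular local of Krull dimension two (`spanFinrank 𝔪 = 2`), `f ∈ 𝔪^ν ∖ 𝔪^{ν+1}` (`ν = ord f ≥ 1`), `(x; w; ℓ)` the
lex-maximal admissible weighted centre germ of `(f)` with `ℓ = w₀ ν` (`a₁ = ℓ/w₀ = ν`). Then at every prime `𝔫 ∋ t⁻¹` of
the cobordant algebra `B = S[t⁻¹, 𝒥ₙtⁿ]` (`𝒥ₙ = weightedMonomialIdeal x w n`) lying over `𝔪` and off the vertex — i.e. at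
every point of `B₊` over the closed point — every `t⁻¹`-saturated transform `g` of `f` has `iotaOrd B_𝔫 g < ν`.

## Proof

A unit expansion `f = Σ_{α∈Δ} a_α x^α + r` (092 `exists_unitExpansion`) has all weights `≥ ℓ` (admissibility, 092
`le_weight_of_mem_weightedMonomialIdeal`); the face `w·α = ℓ = w₀ν` consists, by coprimality, of the exponents
`(ν - w₁ j, w₀ j)`, giving the face polynomial `P = Σ_j ā_j s^j` over the residue field and the face form
`Φ = rho(G) = Σ_j ā_j X₀^{ν-w₁j} X₁^{w₀j}` (K3a `rho_transform`). `ord f = ν` puts `x₀^ν` on the face with a unit coefficient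
(`c₀ ≠ 0`) when `w₁ < w₀`. LEX-MAXIMALITY excludes the two degenerate faces through the COMPETITOR LEMMA
`mem_weightedMonomialIdeal_competitor` («`f ≡ c·y₀^ν (mod 𝒥_{w₀ν+1}(y; w))` ⇒ `f ∈ 𝒥_{(νw₀+1)ν}(y; (νw₀+1, νw₁))`, a
lex-bigger admissible datum»): the monomial face `Φ = c₀X₀^ν` directly, and for `w₁ = 1` the steepenable face
`P = c (s - λ)^ν` after K5d's steepening (`LocalGameEFTSteepening.sub_mul_steepen_pow_mem_of_face`). Then part 1
(`algebraMap_lexFace_notMem_pow`) and K7a (`LocalGameEFTPointMove.pointMove_iotaOrd_lt_of_face`) give the drop. The case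
`w₀ = w₁ = 1` is the tangent cone (`LocalGameEFTDimTwo.tangent_win_or_prepared` + the competitor lemma).

## References

* D. Abramovich, M. H. Quek, B. Schober, *Torus actions, weighted blow-ups, and desingularization of plane curves*,
  arXiv:2507.01232 (v3, 2026), Thm 1.3, Thm 3.5, §5. [AbramovichQuekSchober2025]
* J. Włodarczyk, *Functorial resolution by torus actions*, arXiv:2203.03090, §2.3.9, §3.3. [Wlodarczyk2022]
-/

noncomputable section

open IsLocalRing Literature.AlgebraicGeometry.Resolution Polynomial
open Summit.ResolutionOfSingularities.ResolutionOfSingularities.Cruxes.HypersurfaceCentreConstruction.LocalEngine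
  (iotaOrd)

set_option linter.dupNamespace false -- mandated namespace of this single-conjunct summit

namespace Summit.ResolutionOfSingularities.ResolutionOfSingularities.Theorems

namespace LexMaxOrderDrop

variable {S : Type} [CommRing S]

section Main

variable [IsRegularLocalRing S] (hd : (maximalIdeal S).spanFinrank = 2) {f : S} {x : Fin 2 → S} {w : Fin 2 → ℕ}
  {ℓ ν : ℕ} (hlex : IsLexMaxWeightedCentreGerm S (Ideal.span {f}) x w ℓ) (hℓ : ℓ = w 0 * ν)
  (hfν : f ∈ maximalIdeal S ^ ν) (hfν' : f ∉ maximalIdeal S ^ (ν + 1))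

include hd hlex hℓ hfν hfν'

/-- **AQS Thm 1.3 (3), local-algebra form (ORDER (o25-β)).** `S` regular local of Krull dimension two, `f ∈ 𝔪^ν ∖ 𝔪^{ν+1}`
(`ν ≥ 1`), `(x; w; ℓ)` the lex-maximal admissible weighted centre germ of `(f)` with `ℓ = w₀ν`: at every prime `𝔫 ∋ t⁻¹` of
`B = S[t⁻¹, 𝒥ₙtⁿ]` (`𝒥ₙ = weightedMonomialIdeal x w n`) over `𝔪` and off the vertex, every `t⁻¹`-saturated transform `g` of `f`
with `g ∈ 𝔪_{B_𝔫}²` has `iotaOrd B_𝔫 g < ν` (the H2a′ successor-clause shape; the version without the `𝔪²` hypothesis is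
`iotaOrd_transform_lt_of_isLexMax'`). [cite: AbramovichQuekSchober2025, Thm 1.3 (3), §5] -/
theorem iotaOrd_transform_lt_of_isLexMax (hν : 1 ≤ ν) :
    ∀ (𝔫 : Ideal (extReesAlgebra (weightedMonomialIdeal x w))) [𝔫.IsPrime],
      extReesAlgebra.tInv (weightedMonomialIdeal x w) ∈ 𝔫 →
      (maximalIdeal S).map (algebraMap S (extReesAlgebra (weightedMonomialIdeal x w))) ≤ 𝔫 →
      ¬ (extReesAlgebra.vertexIdeal (weightedMonomialIdeal x w) ≤ 𝔫) →
      ∀ (a : ℕ) (g : extReesAlgebra (weightedMonomialIdeal x w)),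
        algebraMap S (extReesAlgebra (weightedMonomialIdeal x w)) f =
          extReesAlgebra.tInv (weightedMonomialIdeal x w) ^ a * g →
        ¬ (extReesAlgebra.tInv (weightedMonomialIdeal x w) ∣ g) →
        algebraMap (extReesAlgebra (weightedMonomialIdeal x w)) (Localization.AtPrime 𝔫) g ∈
          (maximalIdeal (Localization.AtPrime 𝔫)) ^ 2 →
        iotaOrd (Localization.AtPrime 𝔫)
          (algebraMap (extReesAlgebra (weightedMonomialIdeal x w)) (Localization.AtPrime 𝔫) g) < ν := by
  classical
  obtain ⟨hx, hwpos, hcop, hw10, hℓpos, -, hadm, -, -⟩ := id hlex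
  have hw0 : 0 < w 0 := hwpos 0
  have hw1 : 0 < w 1 := hwpos 1
  have hdimS : ringKrullDim S = (2 : ℕ) := by rw [← IsRegularLocalRing.spanFinrank_maximalIdeal, hd]
  have hfJ : f ∈ weightedMonomialIdeal x w ℓ := by
    rw [← Ideal.span_singleton_le_iff_mem]; exact hadm
  have hxv : (![x 0, x 1] : Fin 2 → S) = x := by
    funext i; fin_cases i <;> rfl
  have hxy : Ideal.span {x 0, x 1} = maximalIdeal S := by rw [← hx, ← Matrix.range_cons_cons_empty, hxv]
  rcases Nat.lt_or_ge (w 1) (w 0) with hlt | hge01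
  swap
  · -- CASE `w₀ = w₁ (= 1)`: the tangent cone (weights `(1, 1)`, `ℓ = ν`)
    have heq : w 0 = w 1 := le_antisymm hge01 hw10
    have hw0' : w 0 = 1 := by
      have h := hcop; rw [← heq] at h; exact (Nat.coprime_self _).mp h
    have hw1' : w 1 = 1 := by rw [← heq]; exact hw0'
    have hw : w = ![1, 1] := by
      funext i; fin_cases i
      · exact hw0'
      · exact hw1'
    rw [← hxv, hw]
    rcases LocalGameEFTDimTwo.tangent_win_or_prepared hd hxy hν hfν hfν' with hwin | ⟨x', y', c, hxy', -, hprep⟩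
    · exact hwin
    · exfalso
      refine not_prepared_of_isLexMax hlex hℓ hν (y := ![y', x']) ?_ (c := c) ?_
      · rw [Matrix.range_cons_cons_empty, Ideal.span_pair_comm, hxy']
      · rw [hw, AQSHeightTwo.weightedMonomialIdeal_swap]
        simpa only [Matrix.cons_val_zero, one_mul] using hprep
  · -- CASE `w₁ < w₀`
    -- one unit expansion, to order `N`
    set N : ℕ := (ν * w 0 + 1) * ν + 1 with hN
    have hℓN : ℓ < N := by
      have h1 : w 0 * ν ≤ ν * w 0 * ν := by
        calc w 0 * ν = 1 * (w 0 * ν) := (one_mul _).symm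
          _ ≤ ν * (w 0 * ν) := Nat.mul_le_mul_right _ hν
          _ = ν * w 0 * ν := by ring
      have e : (ν * w 0 + 1) * ν + 1 = ν * w 0 * ν + ν + 1 := by ring
      rw [hℓ, hN, e]; omega
    have hN0 : 0 < N := Nat.succ_pos _
    obtain ⟨Δ, a, hunit, -, hr⟩ := LocalGameEFTNewton.exists_unitExpansion x hx f N
    have hge : ∀ α ∈ Δ, ℓ ≤ ∑ i, w i * α i :=
      LocalGameEFTNewton.le_weight_of_mem_weightedMonomialIdeal x hx hdimS w hwpos hunit hr hfJ hℓN.le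
    have hf : f = ∑ α ∈ Δ, a α * ∏ i, x i ^ α i + (f - ∑ α ∈ Δ, a α * ∏ i, x i ^ α i) :=
      (add_sub_cancel _ f).symm
    have hwt : ∀ α : Fin 2 → ℕ, ∑ i, w i * α i = w 0 * α 0 + w 1 * α 1 := fun α => by rw [Fin.sum_univ_two]
    -- the vertex `(ν, 0)` is on the face with a unit coefficient
    obtain ⟨-, α₀, hα₀, hα₀ν⟩ :=
      LocalGameEFTNewton.exists_degree_eq_of_not_mem_pow x hx hdimS hunit hr hfν hfν'
        (lt_of_le_of_lt (by rw [hℓ]; exact Nat.le_mul_of_pos_left ν hw0) hℓN)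
    rw [Fin.sum_univ_two] at hα₀ν
    have hα₀1 : α₀ 1 = 0 := by
      by_contra hne
      have h1 := hge α₀ hα₀
      rw [hwt, hℓ] at h1
      have : w 1 * α₀ 1 < w 0 * α₀ 1 := Nat.mul_lt_mul_of_pos_right hlt (Nat.pos_of_ne_zero hne)
      nlinarith
    have hα₀0 : α₀ 0 = ν := by omega
    have hv : (![ν - w 1 * 0, w 0 * 0] : Fin 2 → ℕ) ∈ Δ := by
      have : (![ν - w 1 * 0, w 0 * 0] : Fin 2 → ℕ) = α₀ := by
        ext i; fin_cases i
        · simp [hα₀0]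
        · simp [hα₀1]
      rw [this]; exact hα₀
    -- the face coefficients and the face polynomial
    set I : Ideal S := Ideal.span (Set.range x) with hI
    haveI hImax : I.IsMaximal := by rw [hx]; exact IsLocalRing.maximalIdeal.isMaximal S
    letI : Field (S ⧸ I) := Ideal.Quotient.field I
    set c : ℕ → S := fun j => if (![ν - w 1 * j, w 0 * j] : Fin 2 → ℕ) ∈ Δ then a ![ν - w 1 * j, w 0 * j] else 0 with hc
    set J : ℕ := ν / w 1 with hJ
    set P : (S ⧸ I)[X] := ∑ j ∈ Finset.range (J + 1), Polynomial.monomial j (Ideal.Quotient.mk I (c j)) with hP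
    have hPcoeff : ∀ k, P.coeff k = if k < J + 1 then Ideal.Quotient.mk I (c k) else 0 := by
      intro k
      rw [hP, Polynomial.finsetSum_coeff]
      simp_rw [Polynomial.coeff_monomial]
      split_ifs with hk
      · rw [Finset.sum_eq_single k (fun k' _ hk' => if_neg hk') (fun h => absurd (Finset.mem_range.mpr hk) h),
          if_pos rfl]
      · exact Finset.sum_eq_zero fun k' hk' => if_neg fun h => hk (by rw [← h]; exact Finset.mem_range.mp hk')
    have hdegP : P.natDegree ≤ J := by
      refine Polynomial.natDegree_sum_le_of_forall_le _ _ fun k hk => ?_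
      exact (Polynomial.natDegree_monomial_le _).trans (Nat.lt_succ_iff.mp (Finset.mem_range.mp hk))
    have hres_ne : ∀ {s : S}, IsUnit s → Ideal.Quotient.mk I s ≠ 0 := fun {s} hs h0 => by
      rw [Ideal.Quotient.eq_zero_iff_mem, hx] at h0
      exact (mem_maximalIdeal _).mp h0 hs
    have hc_of_mem : ∀ j, (![ν - w 1 * j, w 0 * j] : Fin 2 → ℕ) ∈ Δ → c j = a ![ν - w 1 * j, w 0 * j] :=
      fun j hj => by rw [hc]; exact if_pos hj
    have hc_of_not_mem : ∀ j, (![ν - w 1 * j, w 0 * j] : Fin 2 → ℕ) ∉ Δ → c j = 0 :=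
      fun j hj => by rw [hc]; exact if_neg hj
    have hP0 : P.coeff 0 ≠ 0 := by
      rw [hPcoeff, if_pos (Nat.succ_pos _), hc_of_mem 0 hv]
      exact hres_ne (hunit _ hv)
    have hfilt : Δ.filter (fun α => ∑ i, w i * α i = ℓ) = Δ.filter (fun α => w 0 * α 0 + w 1 * α 1 = w 0 * ν) := by
      ext α; simp only [Finset.mem_filter, hwt, hℓ]
    -- the face form of the transform is the homogenisation of `P`
    have hΦ : LocalGameEFTPointMove.rho x w hx hd hwpos (LocalGameEFTPointMove.transform x w hx hwpos Δ a ℓ hN0 hr) =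
        ∑ j ∈ Finset.range (P.natDegree + 1),
          MvPolynomial.C (P.coeff j) * MvPolynomial.X 0 ^ (ν - w 1 * j) * MvPolynomial.X 1 ^ (w 0 * j) := by
      rw [LocalGameEFTPointMove.rho_transform x w hx hd hwpos Δ a ℓ hN0 hr hge hℓN, hfilt, ← sum_face_reindex hw0 hw1 hcop Δ]
      have hsub : Finset.range (P.natDegree + 1) ⊆ Finset.range (J + 1) := Finset.range_mono (Nat.succ_le_succ hdegP)
      symm
      rw [Finset.sum_subset hsub (by
          intro k hk hk'
          rw [Polynomial.coeff_eq_zero_of_natDegree_lt (by have := Finset.mem_range.not.mp hk'; omega), map_zero,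
            zero_mul, zero_mul]),
        ← Finset.sum_filter_add_sum_filter_not (Finset.range (J + 1))
          (fun j => (![ν - w 1 * j, w 0 * j] : Fin 2 → ℕ) ∈ Δ),
        Finset.sum_eq_zero (s := (Finset.range (J + 1)).filter
          (fun j => ¬ (![ν - w 1 * j, w 0 * j] : Fin 2 → ℕ) ∈ Δ)) (by
          intro j hj
          obtain ⟨hjr, hjΔ⟩ := Finset.mem_filter.mp hj
          rw [hPcoeff, if_pos (Finset.mem_range.mp hjr), hc_of_not_mem j hjΔ, map_zero, map_zero, zero_mul, zero_mul]),
        add_zero]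
      refine Finset.sum_congr rfl fun j hj => ?_
      obtain ⟨hjr, hjΔ⟩ := Finset.mem_filter.mp hj
      rw [hPcoeff, if_pos (Finset.mem_range.mp hjr), hc_of_mem j hjΔ, Fin.prod_univ_two]
      simp only [Matrix.cons_val_zero, Matrix.cons_val_one, mul_assoc]
      rfl
    -- every face exponent of `Δ` is an `e j` with a unit coefficient `c j`
    have hface_mem : ∀ α ∈ Δ, w 0 * α 0 + w 1 * α 1 = w 0 * ν →
        ∃ j, j < J + 1 ∧ (![ν - w 1 * j, w 0 * j] : Fin 2 → ℕ) ∈ Δ ∧ (![ν - w 1 * j, w 0 * j] : Fin 2 → ℕ) = α := by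
      intro α hα hαeq
      have hsum := sum_face_reindex (ν := ν) hw0 hw1 hcop Δ (fun β => if β = α then (1 : ℕ) else 0)
      rw [Finset.sum_eq_single_of_mem α (Finset.mem_filter.mpr ⟨hα, hαeq⟩) (fun β _ hβ => if_neg hβ), if_pos rfl] at hsum
      obtain ⟨j, hj, hjα⟩ := Finset.exists_ne_zero_of_sum_ne_zero (by rw [hsum]; exact one_ne_zero)
      obtain ⟨hjr, hjΔ⟩ := Finset.mem_filter.mp hj
      have hjeq : (![ν - w 1 * j, w 0 * j] : Fin 2 → ℕ) = α := by
        by_contra h; exact hjα (if_neg h)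
      exact ⟨j, Finset.mem_range.mp hjr, hjΔ, hjeq⟩
    -- exclusion (E1): the face is not the single monomial `x₀^ν`
    have hP1 : 0 < P.natDegree := by
      by_contra hle
      have hdeg0 : P.natDegree = 0 := by omega
      refine not_prepared_of_isLexMax hlex hℓ hν (y := x) hx (c := a ![ν - w 1 * 0, w 0 * 0]) ?_
      have hsplit : f - a ![ν - w 1 * 0, w 0 * 0] * x 0 ^ ν =
          (f - ∑ α ∈ Δ, a α * ∏ i, x i ^ α i) +
            ∑ α ∈ Δ.erase ![ν - w 1 * 0, w 0 * 0], a α * ∏ i, x i ^ α i := by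
        rw [← Finset.add_sum_erase Δ _ hv, Fin.prod_univ_two]
        simp only [Matrix.cons_val_zero, Matrix.cons_val_one, mul_zero, Nat.sub_zero, pow_zero, mul_one]
        ring
      rw [hsplit]
      refine Ideal.add_mem _ ?_ (Ideal.sum_mem _ fun α hα => Ideal.mul_mem_left _ _ ?_)
      · exact (Ideal.pow_le_pow_right (by omega)).trans (pow_le_weightedMonomialIdeal_of_span_eq x w hwpos hx _) hr
      · obtain ⟨hne, hαΔ⟩ := Finset.mem_erase.mp hα
        refine prod_pow_mem_weightedMonomialIdeal x w α ?_
        have h1 := hge α hαΔ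
        rw [hwt, hℓ] at h1
        rw [hwt]
        rcases h1.lt_or_eq with hlt' | heq'
        · omega
        · exfalso
          obtain ⟨j, hjJ, hjΔ, hjeq⟩ := hface_mem α hαΔ heq'.symm
          by_cases hj0 : j = 0
          · exact hne (by rw [← hjeq, hj0])
          · have hcj : P.coeff j ≠ 0 := by
              rw [hPcoeff, if_pos hjJ, hc_of_mem j hjΔ]
              exact hres_ne (hunit _ hjΔ)
            have := Polynomial.le_natDegree_of_ne_zero hcj
            omega
    -- exclusion (E2): for `w₁ = 1` the face polynomial is not `c (s - λ)^ν`
    have hPpow : ¬ ∃ cc l : S ⧸ I, P = C cc * (X - C l) ^ ν := by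
      rintro ⟨cb, lb, hcl⟩
      obtain ⟨cc, rfl⟩ := Ideal.Quotient.mk_surjective cb
      obtain ⟨lam, rfl⟩ := Ideal.Quotient.mk_surjective lb
      have hcc0 : Ideal.Quotient.mk I cc ≠ 0 := by
        intro h0; apply hP0; rw [hcl, h0, map_zero, zero_mul, Polynomial.coeff_zero]
      -- degree count: `ν = natDegree P ≤ J = ν / w₁` forces `w₁ = 1`
      have hdegν : P.natDegree = ν := by
        rw [hcl, Polynomial.natDegree_C_mul hcc0, Polynomial.natDegree_pow, Polynomial.natDegree_X_sub_C, mul_one]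
      have hw11 : w 1 = 1 := by
        have h1 : ν ≤ ν / w 1 := by have h := hdegP; rw [hdegν, hJ] at h; exact h
        have h2 : ν / w 1 * w 1 ≤ ν := Nat.div_mul_le_self ν (w 1)
        by_contra hne
        have h3 : 2 ≤ w 1 := by omega
        have h4 : ν / w 1 * 2 ≤ ν / w 1 * w 1 := Nat.mul_le_mul_left _ h3
        omega
      have hJν : J = ν := by rw [hJ, hw11, Nat.div_one]
      -- `lam` is a unit: `P.coeff 0 = cc · (-lam)^ν ≠ 0`
      have hcoeffk : ∀ k ∈ Finset.range (ν + 1),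
          P.coeff k = Ideal.Quotient.mk I cc * (ν.choose k : S ⧸ I) * (-Ideal.Quotient.mk I lam) ^ (ν - k) := by
        intro k _
        rw [hcl, Polynomial.coeff_C_mul, sub_eq_add_neg, ← Polynomial.C_neg, Polynomial.coeff_X_add_C_pow]
        ring
      have hlam0 : Ideal.Quotient.mk I lam ≠ 0 := by
        intro h0
        apply hP0
        rw [hcoeffk 0 (Finset.mem_range.mpr (Nat.succ_pos _)), h0, neg_zero, Nat.sub_zero, zero_pow (by omega), mul_zero]
      have hlamu : IsUnit lam := by
        by_contra hns
        exact hlam0 (Ideal.Quotient.eq_zero_iff_mem.mpr (by rw [hx]; exact (mem_maximalIdeal _).mpr hns))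
      -- K5's face in the coordinates `(x 1, x 0)`, `b = w 0`: coefficients `aK i = c (ν - i)`
      have hfaceS : f - ∑ i ∈ Finset.range (ν + 1), c (ν - i) * (x 1 ^ (w 0 * (ν - i)) * x 0 ^ i) ∈
          weightedMonomialIdeal ![x 1, x 0] ![1, w 0] (w 0 * ν + 1) := by
        -- the `i`-sum is the face part of the expansion
        have hrefl : ∑ i ∈ Finset.range (ν + 1), c (ν - i) * (x 1 ^ (w 0 * (ν - i)) * x 0 ^ i) =
            ∑ j ∈ Finset.range (ν + 1), c j * (x 1 ^ (w 0 * j) * x 0 ^ (ν - j)) := by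
          have h := Finset.sum_range_reflect (fun j => c j * (x 1 ^ (w 0 * j) * x 0 ^ (ν - j))) (ν + 1)
          rw [← h]
          refine Finset.sum_congr rfl fun i hi => ?_
          have hi' : i ≤ ν := Nat.lt_succ_iff.mp (Finset.mem_range.mp hi)
          simp only [Nat.add_sub_cancel, Nat.sub_sub_self hi']
        have hfaceΔ : ∑ j ∈ Finset.range (ν + 1), c j * (x 1 ^ (w 0 * j) * x 0 ^ (ν - j)) =
            ∑ α ∈ Δ.filter (fun α => w 0 * α 0 + w 1 * α 1 = w 0 * ν), a α * ∏ i, x i ^ α i := by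
          rw [← sum_face_reindex hw0 hw1 hcop Δ, ← hJ, hJν, ← Finset.sum_filter_add_sum_filter_not (Finset.range (ν + 1))
            (fun j => (![ν - w 1 * j, w 0 * j] : Fin 2 → ℕ) ∈ Δ), Finset.sum_eq_zero
            (s := (Finset.range (ν + 1)).filter (fun j => ¬ (![ν - w 1 * j, w 0 * j] : Fin 2 → ℕ) ∈ Δ))
            (fun j hj => by rw [hc_of_not_mem j (Finset.mem_filter.mp hj).2, zero_mul]), add_zero]
          refine Finset.sum_congr rfl fun j hj => ?_
          rw [hc_of_mem j (Finset.mem_filter.mp hj).2, Fin.prod_univ_two]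
          simp only [Matrix.cons_val_zero, Matrix.cons_val_one, hw11, one_mul]
          ring
        have hsplitΔ : ∑ α ∈ Δ, a α * ∏ i, x i ^ α i =
            ∑ α ∈ Δ.filter (fun α => w 0 * α 0 + w 1 * α 1 = w 0 * ν), a α * ∏ i, x i ^ α i +
              ∑ α ∈ Δ.filter (fun α => ¬ w 0 * α 0 + w 1 * α 1 = w 0 * ν), a α * ∏ i, x i ^ α i :=
          (Finset.sum_filter_add_sum_filter_not Δ _ _).symm
        have hkey : f - ∑ i ∈ Finset.range (ν + 1), c (ν - i) * (x 1 ^ (w 0 * (ν - i)) * x 0 ^ i) =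
            (f - ∑ α ∈ Δ, a α * ∏ i, x i ^ α i) +
              ∑ α ∈ Δ.filter (fun α => ¬ w 0 * α 0 + w 1 * α 1 = w 0 * ν), a α * ∏ i, x i ^ α i := by
          rw [hrefl, hfaceΔ, hsplitΔ]; ring
        -- the filtration of `(x 1, x 0)` with weights `(1, w 0)` is that of `x` with `w`
        have hwv : (![w 0, 1] : Fin 2 → ℕ) = w := by
          funext i; fin_cases i
          · rfl
          · exact hw11.symm
        have hJeq : weightedMonomialIdeal ![x 1, x 0] ![1, w 0] (w 0 * ν + 1) = weightedMonomialIdeal x w (w 0 * ν + 1) := by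
          rw [AQSHeightTwo.weightedMonomialIdeal_swap, hxv, hwv]
        rw [hkey, hJeq]
        refine Ideal.add_mem _ ?_ (Ideal.sum_mem _ fun α hα => Ideal.mul_mem_left _ _ ?_)
        · exact (Ideal.pow_le_pow_right (by rw [← hℓ]; omega)).trans
            (pow_le_weightedMonomialIdeal_of_span_eq x w hwpos hx _) hr
        · obtain ⟨hαΔ, hne⟩ := Finset.mem_filter.mp hα
          refine prod_pow_mem_weightedMonomialIdeal x w α ?_
          have h1 := hge α hαΔ
          rw [hwt, hℓ] at h1
          rw [hwt]
          omega
      -- residues: `aK i ≡ c' · C(ν,i) · (-λ')^{ν-i}` with `c' = cc (-lam)^ν`, `λ' = lam⁻¹`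
      set lam' : S := ↑(hlamu.unit⁻¹) with hlam'
      have hll : lam * lam' = 1 := by rw [hlam']; exact hlamu.mul_val_inv
      have hres : ∀ i ∈ Finset.range (ν + 1),
          c (ν - i) - cc * (-lam) ^ ν * (ν.choose i : S) * (-lam') ^ (ν - i) ∈ maximalIdeal S := by
        intro i hi
        have hi' : i ≤ ν := Nat.lt_succ_iff.mp (Finset.mem_range.mp hi)
        rw [← hx, ← Ideal.Quotient.eq_zero_iff_mem, map_sub]
        have hci : Ideal.Quotient.mk I (c (ν - i)) = P.coeff (ν - i) := by
          rw [hPcoeff, if_pos (by rw [hJν]; omega)]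
        rw [hci, hcoeffk (ν - i) (Finset.mem_range.mpr (by omega)), Nat.sub_sub_self hi', Nat.choose_symm hi']
        simp only [map_mul, map_pow, map_neg, map_natCast]
        have hl : Ideal.Quotient.mk I lam * Ideal.Quotient.mk I lam' = 1 := by rw [← map_mul, hll, map_one]
        -- `(-l)^ν · (-l')^{ν-i} = (-l)^i` since `l l' = 1`
        have hpow : (-Ideal.Quotient.mk I lam) ^ ν * (-Ideal.Quotient.mk I lam') ^ (ν - i) =
            (-Ideal.Quotient.mk I lam) ^ i := by
          have : (-Ideal.Quotient.mk I lam) * (-Ideal.Quotient.mk I lam') = 1 := by rw [neg_mul_neg, hl]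
          calc (-Ideal.Quotient.mk I lam) ^ ν * (-Ideal.Quotient.mk I lam') ^ (ν - i)
              = (-Ideal.Quotient.mk I lam) ^ i * ((-Ideal.Quotient.mk I lam) ^ (ν - i) *
                  (-Ideal.Quotient.mk I lam') ^ (ν - i)) := by
                rw [← mul_assoc, ← pow_add, Nat.add_sub_cancel' hi']
            _ = (-Ideal.Quotient.mk I lam) ^ i := by rw [← mul_pow, this, one_pow, mul_one]
        rw [sub_eq_zero]
        calc Ideal.Quotient.mk I cc * (ν.choose i : S ⧸ I) * (-Ideal.Quotient.mk I lam) ^ i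
            = Ideal.Quotient.mk I cc * (ν.choose i : S ⧸ I) *
                ((-Ideal.Quotient.mk I lam) ^ ν * (-Ideal.Quotient.mk I lam') ^ (ν - i)) := by rw [hpow]
          _ = Ideal.Quotient.mk I cc * (-Ideal.Quotient.mk I lam) ^ ν * (ν.choose i : S ⧸ I) *
                (-Ideal.Quotient.mk I lam') ^ (ν - i) := by ring
      -- K5d: steepening prepares `f` at level `w 0` in `(x 1, x 0 - λ' x 1^{w 0})`
      have hx10 : Ideal.span {x 1, x 0} = maximalIdeal S := by rw [Ideal.span_pair_comm, hxy]
      have hsteep := LocalGameEFTSteepening.sub_mul_steepen_pow_mem_of_face hx10 hw0 hfaceS hres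
      -- the competitor in the coordinates `(x 0 - λ' x 1^{w 0}, x 1)`
      refine not_prepared_of_isLexMax hlex hℓ hν (y := ![x 0 - lam' * x 1 ^ w 0, x 1]) ?_
        (c := cc * (-lam) ^ ν) ?_
      · rw [Matrix.range_cons_cons_empty, Ideal.span_pair_comm,
          LocalGameEFTSteepening.span_pair_steepen_eq (x 1) (x 0) lam' hw0, hx10]
      · have hwv : (![w 0, 1] : Fin 2 → ℕ) = w := by
          funext i; fin_cases i
          · rfl
          · exact hw11.symm
        have hJeq2 : weightedMonomialIdeal ![x 0 - lam' * x 1 ^ w 0, x 1] w (w 0 * ν + 1) =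
            weightedMonomialIdeal ![x 1, x 0] ![1, w 0] (w 0 * ν + 1) :=
          calc weightedMonomialIdeal ![x 0 - lam' * x 1 ^ w 0, x 1] w (w 0 * ν + 1)
              = weightedMonomialIdeal ![x 0 - lam' * x 1 ^ w 0, x 1] ![w 0, 1] (w 0 * ν + 1) := by rw [hwv]
            _ = weightedMonomialIdeal ![x 1, x 0 - lam' * x 1 ^ w 0] ![1, w 0] (w 0 * ν + 1) :=
                AQSHeightTwo.weightedMonomialIdeal_swap _ _ _ _ _
            _ = weightedMonomialIdeal ![x 1, x 0] ![1, w 0] (w 0 * ν + 1) :=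
                LocalGameEFTSteepening.weightedMonomialIdeal_steepen_eq _ _ _ _ _
        rw [hJeq2]
        simpa only [Matrix.cons_val_zero] using hsteep
    -- the field step and K7a
    have hdeg : w 1 * P.natDegree ≤ ν := by
      calc w 1 * P.natDegree ≤ w 1 * J := Nat.mul_le_mul_left _ hdegP
        _ ≤ ν := by rw [hJ, mul_comm]; exact Nat.div_mul_le_self ν (w 1)
    refine LocalGameEFTPointMove.pointMove_iotaOrd_lt_of_face x w hx hd hwpos Δ a ℓ hN0 hr hge hℓN hf ν
      fun 𝔫' _ hV' => ?_
    rw [hΦ]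
    refine algebraMap_lexFace_notMem_pow hw0 hw1 hcop hν hdeg hP0 hP1 hPpow rfl 𝔫' fun hle => hV' ?_
    rw [Ideal.span_le]
    rintro _ ⟨i, rfl⟩
    fin_cases i
    · exact hle (Ideal.subset_span (by simp))
    · exact hle (Ideal.subset_span (by simp))

end Main

end LexMaxOrderDrop

end Summit.ResolutionOfSingularities.ResolutionOfSingularities.Theorems

end
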